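import Summits.NavierStokesRegularity.NavierStokesRegularity.Theses.AxisymmetricExtremality
import Summits.NavierStokesRegularity.NavierStokesRegularity.Theorems.AxisymmetricExtremalityAxisymmetricKatoGlobalStubSereginLogSwirlOriginStep4Assembly
import Mathlib.MeasureTheory.Integral.IntervalIntegral.Basic
import HarnessLib

/-!
# Seregin 2022, §2 Step 4 (assembly, V): composition with the landed Step-3 key estimate —
# from `∫(ζΓ)² + ∫(ζΦ)² ≤ K`, `∫_{t₁}^{t₂}(∫|∇(ζΓ)|² + ∫|∇(ζΦ)|²) ≤ K'` to `C(R) → 0` —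
# crux stmt-NavierStokesRegularity-15453 (`AxisymmetricExtremality.AxisymmetricKatoGlobal`), line registered, support for stub `stub_sereginLogSwirlOrigin`

Support file (`--supports stmt-NavierStokesRegularity-15453`; theorems only, everything proved)
toward the registered stub `stub_sereginLogSwirlOrigin` = the named fact
`Literature.Analysis.FluidPDE.seregin2022_logSwirl_regularAtOrigin` (G. Seregin, J. Math. Fluid
Mech. 24 (2022), Paper 27 = arXiv:2201.00153, §2).  Fifth file of the Step-4 assembly.  The Step-3
key estimate is in tree (`cutoff_energy_keyEstimate_of_lemma21`, `…Step3KeyEstimate.lean`) with the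
conclusion, for `[t₁, t₂]` inside the open slab,
`∫(ζΓ)²(t) + ∫(ζΦ)²(t) ≤ K` on `[t₁, t₂]` and `∫_{t₁}^{t₂}(∫|∇(ζΓ)|² + ∫|∇(ζΦ)|²) ≤ K'` —
Bochner integrals, gradients in coordinates `(∂₀·)² + (∂₁·)² + (∂₂·)²`, interval time integral
(`Γ = angVortQuot`, `Φ = radVelQuot ∘ curl`, `ζ = η³`).  The Step-4 assembly
(`cubicC_le_of_twoSeven`, `…Step4Assembly.lean`) consumes the same quantities as `ℝ≥0∞` lower
integrals with the operator norm of `D(ζΦ)` and the time integral over the whole final slab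
`]t₁, 0[`.  This file bridges the two forms (on the final slab `ξ = 1`, so `ζ` is constant in time):

* `lintegral_enorm_sq_eq_ofReal_integral_sq`, `lintegral_enorm_fderiv_sq_eq_ofReal_integral` —
  `∫⁻‖f‖ₑ² = ofReal ∫f²`, `∫⁻‖Df‖ₑ² = ofReal ∫((∂₀f)² + (∂₁f)² + (∂₂f)²)` for `C¹_c` scalars
  (`norm_fderiv_sq_eq_sum_sq`);
* `setLIntegral_Ioo_ofReal_le_of_forall_intervalIntegral_le` — interval bounds
  `∫_{t₁}^{t₂}(E + D) ≤ K'` for all `t₂ < 0`, with `D, E ≥ 0` continuous on `[t₁, 0[`, give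
  `∫⁻_{]t₁,0[} ofReal D ≤ ofReal K'` (exhaustion `]t₁, 0[ = ⋃ₙ ]t₁, t₁/(n+2)]`,
  `setLIntegral_iUnion_of_directed`);
* `lintegral_enorm_sq_le_of_keyEstimate_sup` — the `sup` terms;
* `cubicC_le_of_keyEstimate` (registered) — **Step-3 key-estimate outputs ⇒ `C(R) ≤ C R^{3/2}`** on
  `]0, min(r₁, √|t₁|)]`, in the classical-on-a-slab setting of `cubicC_le_of_twoSeven`, the only
  extra input being the continuity on `[t₁, 0[` of the two dissipation densities
  `s ↦ ∫|∇(ζΓ)(s)|²`, `s ↦ ∫|∇(ζΦ)(s)|²` (which the Step-3 files obtain from joint smoothness,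
  `continuousOn_integral_cutoff`, `…Step3Balance.lean`);
* `tendsto_cubicC_of_keyEstimate` (registered) — hence `SereginSverak2009.cubicC 0 R v → 0` as
  `R → 0⁺`, the hypothesis of the landed endgame `isRegularAtOrigin_of_tendsto_cubicC`.

## References

* G. Seregin, J. Math. Fluid Mech. 24 (2022), Paper No. 27 = arXiv:2201.00153, §2 Step 3 (key
  estimate, arXiv p. 7) and Step 4 (arXiv p. 7). [`Seregin2022LocalAxisym`]
-/

noncomputable section

open Set MeasureTheory Filter Topology Function Metric
open scoped ENNReal NNReal RealInnerProductSpace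
open Literature.Analysis.FluidPDE

-- `<Problem> = <Summit>` duplicates a namespace component by design (lakefile sets the same option).
set_option linter.dupNamespace false

namespace Summit.NavierStokesRegularity.NavierStokesRegularity.Theorems.AxisymmetricKatoGlobal.EulerScaling

/-! ### From the Step-3 key estimate (Bochner integrals, coordinate gradients, interval time
integrals) to the `ℝ≥0∞` form (2.7) consumed by `cubicC_le_of_twoSeven` -/

section KeyEstimateForm

/-- `∫ ‖f‖ₑ² = ofReal (∫ f²)` for a continuous compactly supported real function. [folklore] -/
theorem lintegral_enorm_sq_eq_ofReal_integral_sq {f : EuclideanSpace ℝ (Fin 3) → ℝ}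
    (hf : Continuous f) (hfc : HasCompactSupport f) :
    ∫⁻ x, ‖f x‖ₑ ^ 2 = ENNReal.ofReal (∫ x, f x ^ 2) := by
  have h2 : HasCompactSupport fun x => f x ^ 2 :=
    hfc.mono fun x hx => by
      rw [mem_support] at hx ⊢
      exact fun h => hx (by rw [h]; ring)
  have hi : Integrable (fun x => f x ^ 2) := (hf.pow 2).integrable_of_hasCompactSupport h2
  rw [ofReal_integral_eq_lintegral_ofReal hi (ae_of_all _ fun x => sq_nonneg _)]
  refine lintegral_congr fun x => ?_
  rw [Real.enorm_eq_ofReal_abs, ← ENNReal.ofReal_pow (abs_nonneg _), sq_abs]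

/-- `∫ ‖Df‖ₑ² = ofReal (∫ (∂₀f)² + (∂₁f)² + (∂₂f)²)` for a `C¹` compactly supported real function on
`ℝ³` (`norm_fderiv_sq_eq_sum_sq`). [folklore] -/
theorem lintegral_enorm_fderiv_sq_eq_ofReal_integral {f : EuclideanSpace ℝ (Fin 3) → ℝ}
    (hf : ContDiff ℝ 1 f) (hfc : HasCompactSupport f) :
    ∫⁻ x, ‖fderiv ℝ f x‖ₑ ^ 2 = ENNReal.ofReal (∫ x, (fderiv ℝ f x (EuclideanSpace.single 0 1) ^ 2 +
      fderiv ℝ f x (EuclideanSpace.single 1 1) ^ 2 + fderiv ℝ f x (EuclideanSpace.single 2 1) ^ 2)) := by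
  have hD : Continuous (fderiv ℝ f) := hf.continuous_fderiv one_ne_zero
  have hsq : ∀ i : Fin 3, Integrable fun x => fderiv ℝ f x (EuclideanSpace.single i 1) ^ 2 := fun i => by
    have hci : Continuous fun x => fderiv ℝ f x (EuclideanSpace.single i 1) := hD.clm_apply continuous_const
    have hsi : HasCompactSupport fun x => fderiv ℝ f x (EuclideanSpace.single i 1) ^ 2 :=
      (hfc.fderiv_apply (𝕜 := ℝ) (EuclideanSpace.single i 1)).mono fun x hx => by
        rw [mem_support] at hx ⊢
        exact fun h => hx (by rw [h]; ring)
    exact (hci.pow 2).integrable_of_hasCompactSupport hsi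
  have hi : Integrable fun x => fderiv ℝ f x (EuclideanSpace.single 0 1) ^ 2 +
      fderiv ℝ f x (EuclideanSpace.single 1 1) ^ 2 + fderiv ℝ f x (EuclideanSpace.single 2 1) ^ 2 :=
    ((hsq 0).add (hsq 1)).add (hsq 2)
  rw [ofReal_integral_eq_lintegral_ofReal hi (ae_of_all _ fun x => by positivity)]
  refine lintegral_congr fun x => ?_
  rw [← ofReal_norm, ← ENNReal.ofReal_pow (norm_nonneg _), norm_fderiv_sq_eq_sum_sq]

/-- **From interval bounds to the `ℝ≥0∞` time integral over the final slab**: if `D, E ≥ 0` are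
continuous on `[t₁, 0[` and `∫_{t₁}^{t₂} (E + D) ≤ K'` for every `t₂ ∈ ]t₁, 0[` (the shape of the
Step-3 dissipation bound, uniform in `t₂`), then `∫⁻_{]t₁,0[} ofReal D ≤ ofReal K'` (monotone
exhaustion `]t₁, 0[ = ⋃ₙ ]t₁, t₁/(n+2)]`). [folklore] -/
theorem setLIntegral_Ioo_ofReal_le_of_forall_intervalIntegral_le {D E : ℝ → ℝ} {t₁ K' : ℝ}
    (ht₁ : t₁ < 0) (hDc : ContinuousOn D (Ico t₁ 0)) (hEc : ContinuousOn E (Ico t₁ 0))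
    (hD0 : ∀ t ∈ Ico t₁ 0, 0 ≤ D t) (hE0 : ∀ t ∈ Ico t₁ 0, 0 ≤ E t)
    (h : ∀ t₂ ∈ Ioo t₁ 0, ∫ s in t₁..t₂, (E s + D s) ≤ K') :
    ∫⁻ t in Ioo t₁ 0, ENNReal.ofReal (D t) ≤ ENNReal.ofReal K' := by
  -- the exhaustion `u n = t₁/(n+2) ↑ 0`
  set u : ℕ → ℝ := fun n => t₁ / (n + 2) with hu
  have hu_mem : ∀ n, u n ∈ Ioo t₁ 0 := fun n => by
    have hn : (2 : ℝ) ≤ n + 2 := by have := (Nat.cast_nonneg n : (0 : ℝ) ≤ n); linarith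
    refine ⟨?_, div_neg_of_neg_of_pos ht₁ (by linarith)⟩
    rw [lt_div_iff₀ (by linarith)]
    nlinarith
  have hmono : Monotone fun n => Ioc t₁ (u n) := by
    intro m n hmn
    refine Ioc_subset_Ioc_right (?_ : t₁ / (m + 2) ≤ t₁ / (n + 2))
    have hm2 : (0 : ℝ) < m + 2 := by have := (Nat.cast_nonneg m : (0 : ℝ) ≤ m); linarith
    have hn2 : (0 : ℝ) < n + 2 := by have := (Nat.cast_nonneg n : (0 : ℝ) ≤ n); linarith
    have hmn' : (m : ℝ) + 2 ≤ n + 2 := by have := (Nat.cast_le.2 hmn : (m : ℝ) ≤ n); linarith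
    rw [div_le_div_iff₀ hm2 hn2]
    nlinarith
  have hcover : Ioo t₁ 0 ⊆ ⋃ n, Ioc t₁ (u n) := by
    intro t ht
    obtain ⟨n, hn⟩ := exists_nat_ge (t₁ / t)
    refine mem_iUnion.2 ⟨n, ht.1, ?_⟩
    show t ≤ t₁ / (n + 2)
    rw [le_div_iff₀ (by have := (Nat.cast_nonneg n : (0 : ℝ) ≤ n); linarith)]
    have ht0 : t < 0 := ht.2
    have h1 : (n : ℝ) * t ≤ t₁ := (div_le_iff_of_neg ht0).1 hn
    nlinarith
  -- each truncated integral is `≤ K'`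
  have hpiece : ∀ n, ∫⁻ t in Ioc t₁ (u n), ENNReal.ofReal (D t) ≤ ENNReal.ofReal K' := by
    intro n
    have hsubI : Icc t₁ (u n) ⊆ Ico t₁ 0 := fun t ht => ⟨ht.1, ht.2.trans_lt (hu_mem n).2⟩
    have hint : IntegrableOn (fun s => E s + D s) (Ioc t₁ (u n)) :=
      (((hEc.mono hsubI).add (hDc.mono hsubI)).integrableOn_Icc).mono_set Ioc_subset_Icc_self
    calc ∫⁻ t in Ioc t₁ (u n), ENNReal.ofReal (D t)
        ≤ ∫⁻ t in Ioc t₁ (u n), ENNReal.ofReal (E t + D t) :=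
          setLIntegral_mono' measurableSet_Ioc fun t ht => ENNReal.ofReal_le_ofReal
            (le_add_of_nonneg_left (hE0 t ⟨ht.1.le, ht.2.trans_lt (hu_mem n).2⟩))
      _ = ENNReal.ofReal (∫ t in Ioc t₁ (u n), (E t + D t)) := by
          rw [ofReal_integral_eq_lintegral_ofReal hint]
          refine (ae_restrict_iff' measurableSet_Ioc).2 (ae_of_all _ fun t ht => ?_)
          have ht' : t ∈ Ico t₁ 0 := ⟨ht.1.le, ht.2.trans_lt (hu_mem n).2⟩
          exact add_nonneg (hE0 t ht') (hD0 t ht')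
      _ = ENNReal.ofReal (∫ s in t₁..u n, (E s + D s)) := by
          rw [intervalIntegral.integral_of_le (hu_mem n).1.le]
      _ ≤ ENNReal.ofReal K' := ENNReal.ofReal_le_ofReal (h (u n) (hu_mem n))
  calc ∫⁻ t in Ioo t₁ 0, ENNReal.ofReal (D t)
      ≤ ∫⁻ t in ⋃ n, Ioc t₁ (u n), ENNReal.ofReal (D t) := lintegral_mono_set hcover
    _ = ⨆ n, ∫⁻ t in Ioc t₁ (u n), ENNReal.ofReal (D t) :=
        setLIntegral_iUnion_of_directed _ hmono.directed_le
    _ ≤ ENNReal.ofReal K' := iSup_le hpiece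

variable {v : ℝ → EuclideanSpace ℝ (Fin 3) → EuclideanSpace ℝ (Fin 3)} {ζ : EuclideanSpace ℝ (Fin 3) → ℝ}

/-- **The `sup` terms of the key estimate in `ℝ≥0∞` form**: from
`∫(ζΓ)² + ∫(ζΦ)² ≤ K` (Bochner integrals, `Γ = angVortQuot`, `Φ = radVelQuot ∘ curl` of a `C⁴` slice,
`ζ ∈ C²` compactly supported) to `∫⁻‖ζΓ‖ₑ² ≤ ofReal K` and `∫⁻‖ζΦ‖ₑ² ≤ ofReal K`. [folklore] -/
theorem lintegral_enorm_sq_le_of_keyEstimate_sup {u : EuclideanSpace ℝ (Fin 3) → EuclideanSpace ℝ (Fin 3)}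
    {K : ℝ} (hu : ContDiff ℝ 4 u) (hζ : ContDiff ℝ 2 ζ) (hζc : HasCompactSupport ζ)
    (hK : (∫ x, (ζ x * angVortQuot u x) ^ 2) + (∫ x, (ζ x * radVelQuot (curl u) x) ^ 2) ≤ K) :
    ∫⁻ x, ‖ζ x * angVortQuot u x‖ₑ ^ 2 ≤ ENNReal.ofReal K ∧
      ∫⁻ x, ‖ζ x * radVelQuot (curl u) x‖ₑ ^ 2 ≤ ENNReal.ofReal K := by
  have hΓ1 : ContDiff ℝ 1 (angVortQuot u) := contDiff_angVortQuot (n := 1) (by exact_mod_cast hu)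
  have hω3 : ContDiff ℝ 3 (curl u) := contDiff_curl_of_succ (n := 3) (by exact_mod_cast hu)
  have hΦ1 : ContDiff ℝ 1 (radVelQuot (curl u)) := contDiff_radVelQuot (n := 1) (by exact_mod_cast hω3)
  have eΓ := lintegral_enorm_sq_eq_ofReal_integral_sq (f := fun x => ζ x * angVortQuot u x)
    (hζ.continuous.mul hΓ1.continuous) hζc.mul_right
  have eΦ := lintegral_enorm_sq_eq_ofReal_integral_sq (f := fun x => ζ x * radVelQuot (curl u) x)
    (hζ.continuous.mul hΦ1.continuous) hζc.mul_right
  have h0Γ : 0 ≤ ∫ x, (ζ x * angVortQuot u x) ^ 2 := integral_nonneg fun x => sq_nonneg _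
  have h0Φ : 0 ≤ ∫ x, (ζ x * radVelQuot (curl u) x) ^ 2 := integral_nonneg fun x => sq_nonneg _
  rw [eΓ, eΦ]
  exact ⟨ENNReal.ofReal_le_ofReal (by linarith), ENNReal.ofReal_le_ofReal (by linarith)⟩

/-- **Seregin 2022, §2 Step 4 composed with the Step-3 key estimate: `C(R) ≤ C R^{3/2}`.** Same
classical-on-a-slab setting as `cubicC_le_of_twoSeven` (slices `v t ∈ C⁴(ℝ³)` on `]t₁, 0[`,
axisymmetric, divergence free on an open `U`; `C²` cut-off `ζ = η³` with `tsupport ζ ⊆ U ∩ 𝒞`,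
`ζ = 1` on `𝒞(r₁)`; energy class; `|v| ≤ L` on `supp ∇ζ`), with the Step-3 bounds in exactly the
output form of the landed key estimate `cutoff_energy_keyEstimate_of_lemma21`
(`…Step3KeyEstimate.lean`, there with `ζ s = ζ` on the final slab where `ξ = 1`): the `sup` term
`∫(ζΓ)²(t) + ∫(ζΦ)²(t) ≤ K` for `t ∈ ]t₁, 0[` and the dissipation
`∫_{t₁}^{t₂}(∫|∇(ζΓ)|² + ∫|∇(ζΦ)|²) ≤ K'` for every `t₂ ∈ ]t₁, 0[` (Bochner integrals, coordinate
gradients, interval time integral), together with the continuity on `[t₁, 0[` of the two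
dissipation densities (exported by the Step-3 files through `continuousOn_integral_cutoff`).
[cite: Seregin2022LocalAxisym, §2 Step 3 (key estimate) and Step 4 (arXiv:2201.00153 p. 7)] -/
theorem cubicC_le_of_keyEstimate : ∀ (v : ℝ → EuclideanSpace ℝ (Fin 3) → EuclideanSpace ℝ (Fin 3)) (ζ : EuclideanSpace ℝ (Fin 3) → ℝ) (U : Set (EuclideanSpace ℝ (Fin 3))) (t₁ r₁ L K K' : ℝ) (A : ℝ≥0), t₁ < 0 → 0 < r₁ → r₁ ≤ 1 → AEStronglyMeasurable (uncurry v) (volume.restrict (SereginSverak2009.parCyl 0 r₁)) → (∀ t ∈ Ioo t₁ 0, ContDiff ℝ 4 (v t)) → (∀ t ∈ Ioo t₁ 0, IsAxisymmetric (v t)) → IsOpen U → (∀ t ∈ Ioo t₁ 0, ∀ x ∈ U, VectorCalculus.divergence (v t) x = 0) → ContDiff ℝ 2 ζ → tsupport ζ ⊆ U → tsupport ζ ⊆ SereginSverak2009.spaceCyl 0 1 → (∀ x ∈ SereginSverak2009.spaceCyl 0 r₁, ζ x = 1) → (∀ t ∈ Ioo t₁ 0, ∫⁻ x in SereginSverak2009.spaceCyl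 0 1, ‖v t x‖ₑ ^ 2 ≤ A) → (∀ t ∈ Ioo t₁ 0, ∀ x, fderiv ℝ ζ x ≠ 0 → ‖v t x‖ ≤ L) → (∀ t ∈ Ioo t₁ 0, (∫ x, (ζ x * angVortQuot (v t) x) ^ 2) + (∫ x, (ζ x * radVelQuot (curl (v t)) x) ^ 2) ≤ K) → ContinuousOn (fun s => ∫ x, (fderiv ℝ (fun y => ζ y * angVortQuot (v s) y) x (EuclideanSpace.single 0 1) ^ 2 + fderiv ℝ (fun y => ζ y * angVortQuot (v s) y) x (EuclideanSpace.single 1 1) ^ 2 + fderiv ℝ (fun y => ζ y * angVortQuot (v s) y) x (EuclideanSpace.single 2 1) ^ 2)) (Ico t₁ 0) → ContinuousOn (fun s => ∫ x, (fderiv ℝ (fun y => ζ y * radVelQuot (curl (v s)) y) x (EuclideanSpace.single 0 1) ^ 2 + fderiv ℝ (fun y => ζ y * radVelQuot (curl (v s)) y) x (EuclideanSpace.single 1 1) ^ 2 + fderiv ℝ (fun y => ζ y * radVelQuot (curl (v s)) y) x (EuclideanSpace.single 2 1) ^ 2)) (Ico t₁ 0) → (∀ t₂ ∈ Ioo t₁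 0, ∫ s in t₁..t₂, ((∫ x, (fderiv ℝ (fun y => ζ y * angVortQuot (v s) y) x (EuclideanSpace.single 0 1) ^ 2 + fderiv ℝ (fun y => ζ y * angVortQuot (v s) y) x (EuclideanSpace.single 1 1) ^ 2 + fderiv ℝ (fun y => ζ y * angVortQuot (v s) y) x (EuclideanSpace.single 2 1) ^ 2)) + (∫ x, (fderiv ℝ (fun y => ζ y * radVelQuot (curl (v s)) y) x (EuclideanSpace.single 0 1) ^ 2 + fderiv ℝ (fun y => ζ y * radVelQuot (curl (v s)) y) x (EuclideanSpace.single 1 1) ^ 2 + fderiv ℝ (fun y => ζ y * radVelQuot (curl (v s)) y) x (EuclideanSpace.single 2 1) ^ 2))) ≤ K') → ∃ C : ℝ≥0, ∀ R ∈ Ioc 0 (min r₁ (Real.sqrt (-t₁))), SereginSverak2009.cubicC 0 R v ≤ C * ENNReal.ofReal R ^ (3 / 2 : ℝ) := by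
  intro v ζ U t₁ r₁ L K K' A ht₁ hr₁ hr₁1 hmeas hv hax hU hdiv hζ hζU hζ1 hζr₁ hA hLv hE hDΓc hDΦc hD
  have hζc : HasCompactSupport ζ := hasCompactSupport_of_tsupport_subset_spaceCyl hζ1
  -- the `sup` terms
  have hsup := fun t (ht : t ∈ Ioo t₁ 0) => lintegral_enorm_sq_le_of_keyEstimate_sup (hv t ht) hζ hζc (hE t ht)
  -- the dissipation of `ζΦ`
  have hΦ1 : ∀ t ∈ Ioo t₁ 0, ContDiff ℝ 1 (fun y => ζ y * radVelQuot (curl (v t)) y) := fun t ht =>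
    (hζ.of_le (by norm_num)).mul (contDiff_radVelQuot (n := 1)
      (by exact_mod_cast (contDiff_curl_of_succ (n := 3) (by exact_mod_cast hv t ht))))
  have hD0Γ : ∀ t ∈ Ico t₁ 0, 0 ≤ ∫ x, (fderiv ℝ (fun y => ζ y * angVortQuot (v t) y) x (EuclideanSpace.single 0 1) ^ 2 + fderiv ℝ (fun y => ζ y * angVortQuot (v t) y) x (EuclideanSpace.single 1 1) ^ 2 + fderiv ℝ (fun y => ζ y * angVortQuot (v t) y) x (EuclideanSpace.single 2 1) ^ 2) :=
    fun t _ => integral_nonneg fun x => by positivity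
  have hD0Φ : ∀ t ∈ Ico t₁ 0, 0 ≤ ∫ x, (fderiv ℝ (fun y => ζ y * radVelQuot (curl (v t)) y) x (EuclideanSpace.single 0 1) ^ 2 + fderiv ℝ (fun y => ζ y * radVelQuot (curl (v t)) y) x (EuclideanSpace.single 1 1) ^ 2 + fderiv ℝ (fun y => ζ y * radVelQuot (curl (v t)) y) x (EuclideanSpace.single 2 1) ^ 2) :=
    fun t _ => integral_nonneg fun x => by positivity
  have hDΦ := setLIntegral_Ioo_ofReal_le_of_forall_intervalIntegral_le ht₁ hDΦc hDΓc hD0Φ hD0Γ hD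
  have hΦ' : ∫⁻ t in Ioo t₁ 0, ∫⁻ x, ‖fderiv ℝ (fun y => ζ y * radVelQuot (curl (v t)) y) x‖ₑ ^ 2 ≤
      ENNReal.ofReal K' := by
    refine le_trans (le_of_eq ?_) hDΦ
    refine setLIntegral_congr_fun measurableSet_Ioo fun t ht => ?_
    exact lintegral_enorm_fderiv_sq_eq_ofReal_integral (hΦ1 t ht) hζc.mul_right
  exact cubicC_le_of_twoSeven v ζ U t₁ r₁ L A K.toNNReal K.toNNReal K'.toNNReal ht₁ hr₁ hr₁1 hmeas hv
    hax hU hdiv hζ hζU hζ1 hζr₁ hA hLv (fun t ht => (hsup t ht).1) (fun t ht => (hsup t ht).2) hΦ'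

/-- **Seregin 2022, §2 Step 4 composed with the Step-3 key estimate: `C(R) → 0` as `R → 0⁺`**
(the hypothesis of the landed endgame `isRegularAtOrigin_of_tendsto_cubicC`), under the hypotheses of
`cubicC_le_of_keyEstimate`. [cite: Seregin2022LocalAxisym, §2 Step 3 (key estimate) and Step 4 (arXiv:2201.00153 p. 7)] -/
theorem tendsto_cubicC_of_keyEstimate : ∀ (v : ℝ → EuclideanSpace ℝ (Fin 3) → EuclideanSpace ℝ (Fin 3)) (ζ : EuclideanSpace ℝ (Fin 3) → ℝ) (U : Set (EuclideanSpace ℝ (Fin 3))) (t₁ r₁ L K K' : ℝ) (A : ℝ≥0), t₁ < 0 → 0 < r₁ → r₁ ≤ 1 → AEStronglyMeasurable (uncurry v) (volume.restrict (SereginSverak2009.parCyl 0 r₁)) → (∀ t ∈ Ioo t₁ 0, ContDiff ℝ 4 (v t)) → (∀ t ∈ Ioo t₁ 0, IsAxisymmetric (v t)) → IsOpen U → (∀ t ∈ Ioo t₁ 0, ∀ x ∈ U, VectorCalculus.divergence (v t) x = 0) → ContDiff ℝ 2 ζ → tsupport ζ ⊆ U → tsupport ζ ⊆ SereginSverak2009.spaceCyl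 0 1 → (∀ x ∈ SereginSverak2009.spaceCyl 0 r₁, ζ x = 1) → (∀ t ∈ Ioo t₁ 0, ∫⁻ x in SereginSverak2009.spaceCyl 0 1, ‖v t x‖ₑ ^ 2 ≤ A) → (∀ t ∈ Ioo t₁ 0, ∀ x, fderiv ℝ ζ x ≠ 0 → ‖v t x‖ ≤ L) → (∀ t ∈ Ioo t₁ 0, (∫ x, (ζ x * angVortQuot (v t) x) ^ 2) + (∫ x, (ζ x * radVelQuot (curl (v t)) x) ^ 2) ≤ K) → ContinuousOn (fun s => ∫ x, (fderiv ℝ (fun y => ζ y * angVortQuot (v s) y) x (EuclideanSpace.single 0 1) ^ 2 + fderiv ℝ (fun y => ζ y * angVortQuot (v s) y) x (EuclideanSpace.single 1 1) ^ 2 + fderiv ℝ (fun y => ζ y * angVortQuot (v s) y) x (EuclideanSpace.single 2 1) ^ 2)) (Ico t₁ 0) → ContinuousOn (fun s => ∫ x, (fderiv ℝ (fun y => ζ y * radVelQuot (curl (v s)) y) x (EuclideanSpace.single 0 1) ^ 2 + fderiv ℝ (fun y => ζ y * radVelQuot (curl (v s)) y) x (EuclideanSpace.single 1 1) ^ 2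 + fderiv ℝ (fun y => ζ y * radVelQuot (curl (v s)) y) x (EuclideanSpace.single 2 1) ^ 2)) (Ico t₁ 0) → (∀ t₂ ∈ Ioo t₁ 0, ∫ s in t₁..t₂, ((∫ x, (fderiv ℝ (fun y => ζ y * angVortQuot (v s) y) x (EuclideanSpace.single 0 1) ^ 2 + fderiv ℝ (fun y => ζ y * angVortQuot (v s) y) x (EuclideanSpace.single 1 1) ^ 2 + fderiv ℝ (fun y => ζ y * angVortQuot (v s) y) x (EuclideanSpace.single 2 1) ^ 2)) + (∫ x, (fderiv ℝ (fun y => ζ y * radVelQuot (curl (v s)) y) x (EuclideanSpace.single 0 1) ^ 2 + fderiv ℝ (fun y => ζ y * radVelQuot (curl (v s)) y) x (EuclideanSpace.single 1 1) ^ 2 + fderiv ℝ (fun y => ζ y * radVelQuot (curl (v s)) y) x (EuclideanSpace.single 2 1) ^ 2))) ≤ K') → Tendsto (fun R => SereginSverak2009.cubicC 0 R v) (𝓝[>] 0) (𝓝 0) := by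
  intro v ζ U t₁ r₁ L K K' A ht₁ hr₁ hr₁1 hmeas hv hax hU hdiv hζ hζU hζ1 hζr₁ hA hLv hE hDΓc hDΦc hD
  obtain ⟨C, hC⟩ := cubicC_le_of_keyEstimate v ζ U t₁ r₁ L K K' A ht₁ hr₁ hr₁1 hmeas hv hax hU hdiv hζ hζU
    hζ1 hζr₁ hA hLv hE hDΓc hDΦc hD
  exact tendsto_cubicC_of_le_rpow (lt_min hr₁ (Real.sqrt_pos.2 (by linarith))) (by norm_num) hC

end KeyEstimateForm

end Summit.NavierStokesRegularity.NavierStokesRegularity.Theorems.AxisymmetricKatoGlobal.EulerScaling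

end
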